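import Summits.HubbardSuperconductivity.HubbardSuperconductivity.Theorems.WidthHaldaneTubeLandauWindow

/-!
# Landau localisation: the stiffness floor of the tube from window states only

Support file for the tube cruxes stated over `WidthHaldaneDefs` (routes `WidthHaldane`,
`SeamInduction`; items stmt-HubbardSuperconductivity-16311/16312/18509/18510), all PROVED, no
definitions, no named facts; continues `WidthHaldaneTubeLandauForm` / `WidthHaldaneTubeLandauWindow`
(column forms `K(ψ)`, `J(ψ)`, Landau identity, floor transfer, reverse Bloch bound). It settles
falsifier (1) of the idea card `landau-window-yrast` of crux stmt-16312 ("prove the reduction in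
Lean; if the two-case estimate does not close, the card dies before any physics") affirmatively, in
the WINDOW-LOCALISED form the card argues for (window `Re⟨ψ,H₀ψ⟩ - E(0) ≤ wM/L` of the untwisted
sector `(N, S^z = 0)`):

* `abs_longCurrent_le_of_excitation` — reverse Bloch with Jordan's inequality:
  `|J(ψ)| ≤ (L/2)(Re⟨ψ,H₀ψ⟩ - E(0) + 2π²M/L)` (inside the window the current is `O(M)`);
* `landauForm_ge_of_windowState` — a window state with kinetic floor `K ≥ k'LM` obeying the Landau
  criterion `min(J²/(2κLM), s|J|/L) ≤ Re⟨ψ,H₀ψ⟩ - E(0)` has Landau form at flux `0 ≤ θ ≤ min(s, 2)`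
  at least `E(0) + (k'(1 - (θ/L)²/12) - κ)θ²M/(2L)` (complete the square; `sin A ≤ A`;
  `1 - cos A ≥ A²/2 - A⁴/24`);
* **`tubeEnergy_zero_add_le_of_landauWindow`** — KINETIC FLOOR + LANDAU CRITERION ON WINDOW STATES
  ONLY ⇒ `E(θ) ≥ E(0) + (k'(1 - (θ/L)²/12) - κ)θ²M/(2L)`, the states above the window being
  discharged by the reverse Bloch bound once `θ²k'/2 + θπ² + θ² ≤ w(1 - θ/2)`;
* **`tubeStiffness_ge_of_landauWindow`** (`θ₀ = π/3`, one window `w ≥ 27`, `k' ≤ 2`, `s ≥ π/3`):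
  `ρ̃_{L,M}(U,δ) ≥ k'(1 - (π/3L)²/12) - κ ≥ k' - κ - 1/(5L²)`;
* **`landauCriterion_of_window`** — bridge to the registered sub-goal `stiffnessOfLandauCriterion`
  (criterion for EVERY unit sector vector): the window version implies the global one with slope
  `min(s, 2w/(w + 2π²))`, which still exceeds `π/3` for `w ≥ 22`.

Not progress on the open core: the kinetic floor (i) and the Landau criterion (ii) on window states
carry all the physics (the card's ★ stub); this file certifies that they suffice, with explicit
constants, and that (ii) is needed nowhere outside an `O(M/L)` energy window.
References: idea card `landau-window-yrast` (crux stmt-16312); Scalapino–White–Zhang, PRB 47 (1993)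
7995, §II; H. Watanabe, J. Stat. Phys. 177 (2019) 717, §2.2–§4.1; F. Bloch, Phys. Rev. A 7 (1973) 2187.
-/

noncomputable section

namespace Summit.HubbardSuperconductivity.HubbardSuperconductivity.Theorems.WidthHaldane

set_option linter.dupNamespace false -- summit = problem name (single-conjunct summit), D-0017

open scoped BigOperators Classical Matrix ComplexConjugate
open Matrix Literature.MathematicalPhysics.QuantumLattice

section LandauWindow

variable (L M : ℕ) [NeZero L] [NeZero M] (Λ : Type) [LinearOrder Λ] [Fintype Λ]
  (e : Λ ≃ ZMod L × ZMod M)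

/-- **Reverse Bloch bound, explicit form** (`L ≥ 3`, Jordan's inequality `sin(π/L) ≥ 2/L`): for every
unit vector `ψ` of the sector `(N, 0)`, `|J(ψ)| ≤ (L/2)·(Re⟨ψ, H₀ψ⟩ - E_{L,M}(U; 0, N) + 2π²M/L)` —
inside the window `{Re⟨ψ,H₀ψ⟩ - E(0) ≤ C M/L}` the current is `O(M)`. [cite: Watanabe2019, §2.2.3 and §4.1] -/
theorem abs_longCurrent_le_of_excitation (hL : 3 ≤ L) (U : ℝ) (N : ℕ) {ψ : Fock (Orb Λ)}
    (hψ : ψ ∈ szSector N 0) (h1 : star ψ ⬝ᵥ ψ = 1) :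
    |∑ a : ZMod L, ∑ b : ZMod M, ∑ σ : Fin 2,
        (expect (creation (orb (e.symm (a, b)) σ) * annihilation (orb (e.symm (a - 1, b)) σ) -
          creation (orb (e.symm (a - 1, b)) σ) * annihilation (orb (e.symm (a, b)) σ)) ψ).im| ≤
      (L : ℝ) / 2 * (((expect (tubeH0 L M Λ e U) ψ).re - tubeEnergy L M Λ e U 0 N) + 2 * Real.pi ^ 2 * M / L) := by
  have hL0 : (0 : ℝ) < L := by exact_mod_cast Nat.pos_of_ne_zero (NeZero.ne L)
  have hL2 : (2 : ℝ) ≤ L := by exact_mod_cast (show 2 ≤ L by omega)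
  have h := sin_mul_abs_longCurrent_le L M Λ e hL U N hψ h1
  have hsin : 2 / Real.pi * (Real.pi / L) ≤ Real.sin (Real.pi / L) :=
    Real.mul_le_sin (by positivity) (by
      rw [div_le_div_iff₀ hL0 two_pos]
      nlinarith [Real.pi_pos])
  have h2L : 2 / Real.pi * (Real.pi / L) = 2 / L := by
    field_simp
  rw [h2L] at hsin
  set J := |∑ a : ZMod L, ∑ b : ZMod M, ∑ σ : Fin 2,
      (expect (creation (orb (e.symm (a, b)) σ) * annihilation (orb (e.symm (a - 1, b)) σ) -
        creation (orb (e.symm (a - 1, b)) σ) * annihilation (orb (e.symm (a, b)) σ)) ψ).im|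
  have hJ0 : 0 ≤ J := abs_nonneg _
  have h4 : 2 / (L : ℝ) * J ≤
      ((expect (tubeH0 L M Λ e U) ψ).re - tubeEnergy L M Λ e U 0 N) + 2 * Real.pi ^ 2 * M / L :=
    (mul_le_mul_of_nonneg_right hsin hJ0).trans h
  rw [show 2 / (L : ℝ) * J = J / (L / 2) by field_simp] at h4
  rwa [div_le_iff₀' (by positivity)] at h4

omit [NeZero L] [NeZero M] [LinearOrder Λ] [Fintype Λ] in
/-- `cos x ≤ 1 - x²/2 + x⁴/24` on `[0, 2]` (`x - x³/6 ≤ sin x` at `x/2`, `cos x = 1 - 2sin²(x/2)`). [folklore] -/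
theorem cos_le_one_sub_sq_div_two_add_pow_four {x : ℝ} (hx0 : 0 ≤ x) (hx2 : x ≤ 2) :
    Real.cos x ≤ 1 - x ^ 2 / 2 + x ^ 4 / 24 := by
  have hs := Real.sin_ge_sub_cube (x := x / 2) (by positivity)
  have hy0 : 0 ≤ x / 2 := by positivity
  have hy1 : x / 2 ≤ 1 := by linarith
  have hy2 : (x / 2) ^ 2 ≤ 1 := by nlinarith
  have h0 : 0 ≤ x / 2 - (x / 2) ^ 3 / 6 := by nlinarith [mul_le_mul_of_nonneg_left hy2 hy0]
  have hsq := pow_le_pow_left₀ h0 hs 2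
  have hc : Real.cos x = 1 - 2 * Real.sin (x / 2) ^ 2 := by
    have h2 : Real.cos x = Real.cos (2 * (x / 2)) := by ring_nf
    rw [h2, Real.cos_two_mul]
    nlinarith [Real.sin_sq_add_cos_sq (x / 2)]
  rw [hc]
  nlinarith [hsq, pow_nonneg hx0 6]

/-- **Window states: the kinetic floor and the Landau criterion price the flux** (`L ≥ 3`,
`0 ≤ θ ≤ s`, `θ ≤ 2`, `κ > 0`, `k' ≥ 0`). For a unit sector vector `ψ` with longitudinal kinetic form
`K(ψ) ≥ k' LM` and obeying the Landau criterion `min(J(ψ)²/(2κLM), s|J(ψ)|/L) ≤ Re⟨ψ,H₀ψ⟩ - E(0)`,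
the Landau form at flux `θ` is at least `E(0) + (k'(1 - (θ/L)²/12) - κ) θ²M/(2L)` (quadratic branch:
complete the square in the current; linear branch: `sin(θ/L) ≤ θ/L ≤ s/L`; kinetic term:
`1 - cos A ≥ A²/2 - A⁴/24`). [cite: Watanabe2019, §2.2.3 and §4.1] -/
theorem landauForm_ge_of_windowState (hL : 3 ≤ L) (U : ℝ) (N : ℕ) (κ s k' θ : ℝ) (hκ : 0 < κ)
    (hθ0 : 0 ≤ θ) (hθs : θ ≤ s) (hθ2 : θ ≤ 2) (hk' : 0 ≤ k') {ψ : Fock (Orb Λ)}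
    (hK : k' * ((L : ℝ) * M) ≤ (∑ a : ZMod L, ∑ b : ZMod M, ∑ σ : Fin 2,
          (expect (creation (orb (e.symm (a, b)) σ) * annihilation (orb (e.symm (a - 1, b)) σ) +
            creation (orb (e.symm (a - 1, b)) σ) * annihilation (orb (e.symm (a, b)) σ)) ψ).re))
    (hLC : min ((∑ a : ZMod L, ∑ b : ZMod M, ∑ σ : Fin 2,
          (expect (creation (orb (e.symm (a, b)) σ) * annihilation (orb (e.symm (a - 1, b)) σ) -
            creation (orb (e.symm (a - 1, b)) σ) * annihilation (orb (e.symm (a, b)) σ)) ψ).im) ^ 2 / (2 * κ * ((L : ℝ) * M))) (s * |(∑ a : ZMod L, ∑ b : ZMod M, ∑ σ : Fin 2,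
          (expect (creation (orb (e.symm (a, b)) σ) * annihilation (orb (e.symm (a - 1, b)) σ) -
            creation (orb (e.symm (a - 1, b)) σ) * annihilation (orb (e.symm (a, b)) σ)) ψ).im)| / L) ≤
      (expect (tubeH0 L M Λ e U) ψ).re - tubeEnergy L M Λ e U 0 N) :
    tubeEnergy L M Λ e U 0 N + (k' * (1 - (θ / L) ^ 2 / 12) - κ) * (θ ^ 2 * M / (2 * L)) ≤
      (expect (tubeH0 L M Λ e U) ψ).re + (1 - Real.cos (θ / L)) * (∑ a : ZMod L, ∑ b : ZMod M, ∑ σ : Fin 2,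
          (expect (creation (orb (e.symm (a, b)) σ) * annihilation (orb (e.symm (a - 1, b)) σ) +
            creation (orb (e.symm (a - 1, b)) σ) * annihilation (orb (e.symm (a, b)) σ)) ψ).re) + Real.sin (θ / L) * (∑ a : ZMod L, ∑ b : ZMod M, ∑ σ : Fin 2,
          (expect (creation (orb (e.symm (a, b)) σ) * annihilation (orb (e.symm (a - 1, b)) σ) -
            creation (orb (e.symm (a - 1, b)) σ) * annihilation (orb (e.symm (a, b)) σ)) ψ).im) := by
  have hL0 : (0 : ℝ) < L := by exact_mod_cast Nat.pos_of_ne_zero (NeZero.ne L)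
  have hM0 : (0 : ℝ) < M := by exact_mod_cast Nat.pos_of_ne_zero (NeZero.ne M)
  have hL3 : (3 : ℝ) ≤ L := by exact_mod_cast hL
  set K := (∑ a : ZMod L, ∑ b : ZMod M, ∑ σ : Fin 2,
          (expect (creation (orb (e.symm (a, b)) σ) * annihilation (orb (e.symm (a - 1, b)) σ) +
            creation (orb (e.symm (a - 1, b)) σ) * annihilation (orb (e.symm (a, b)) σ)) ψ).re)
  set J := (∑ a : ZMod L, ∑ b : ZMod M, ∑ σ : Fin 2,
          (expect (creation (orb (e.symm (a, b)) σ) * annihilation (orb (e.symm (a - 1, b)) σ) -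
            creation (orb (e.symm (a - 1, b)) σ) * annihilation (orb (e.symm (a, b)) σ)) ψ).im)
  set R := (expect (tubeH0 L M Λ e U) ψ).re
  set E₀ := tubeEnergy L M Λ e U 0 N
  set V : ℝ := (L : ℝ) * M with hV
  set A : ℝ := θ / L with hA
  have hV0 : 0 < V := by positivity
  have hA0 : 0 ≤ A := by positivity
  have hA1 : A ≤ 2 := by
    rw [hA, div_le_iff₀ hL0]
    nlinarith
  have hAL : A * L = θ := by rw [hA]; field_simp
  have hmain : θ ^ 2 * (M : ℝ) / (2 * L) = A ^ 2 * V / 2 := by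
    rw [hA, hV]; field_simp
  rw [hmain]
  have hsinA : Real.sin A ≤ A := Real.sin_le hA0
  have hsin0 : 0 ≤ Real.sin A :=
    Real.sin_nonneg_of_nonneg_of_le_pi hA0 (by linarith [Real.pi_gt_three])
  have hcosL : A ^ 2 / 2 - A ^ 4 / 24 ≤ 1 - Real.cos A := by
    have := cos_le_one_sub_sq_div_two_add_pow_four hA0 hA1
    linarith
  have hc0 : 0 ≤ 1 - Real.cos A := by linarith [Real.cos_le_one A]
  -- kinetic part
  have hkin : (A ^ 2 / 2 - A ^ 4 / 24) * (k' * V) ≤ (1 - Real.cos A) * K := by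
    have h' : (1 - Real.cos A) * (k' * V) ≤ (1 - Real.cos A) * K := mul_le_mul_of_nonneg_left hK hc0
    have h'' : (A ^ 2 / 2 - A ^ 4 / 24) * (k' * V) ≤ (1 - Real.cos A) * (k' * V) :=
      mul_le_mul_of_nonneg_right hcosL (by positivity)
    linarith
  -- current part
  have hcur : -(κ * V * A ^ 2 / 2) ≤ (R - E₀) + Real.sin A * J := by
    rcases min_le_iff.mp hLC with hq | hl
    · -- quadratic branch: complete the square
      have hq' : J ^ 2 ≤ (R - E₀) * (2 * κ * V) := (div_le_iff₀ (by positivity)).mp hq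
      have hs2 : Real.sin A ^ 2 ≤ A ^ 2 := Real.sin_sq_le_sq
      have key : 0 ≤ 2 * κ * V * ((R - E₀) + Real.sin A * J + κ * V * A ^ 2 / 2) := by
        nlinarith [sq_nonneg (J + κ * V * Real.sin A),
          mul_le_mul_of_nonneg_left hs2 (by positivity : (0 : ℝ) ≤ κ ^ 2 * V ^ 2)]
      have key' := (mul_nonneg_iff_of_pos_left (by positivity : (0 : ℝ) < 2 * κ * V)).mp key
      linarith
    · -- linear branch: `A |J| ≤ s |J| / L ≤ R - E₀`
      have hl' : s * |J| ≤ (R - E₀) * L := (div_le_iff₀ hL0).mp hl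
      have h2 : A * |J| * L ≤ (R - E₀) * L := by
        rw [mul_right_comm, hAL]
        exact (mul_le_mul_of_nonneg_right hθs (abs_nonneg _)).trans hl'
      have h3 : A * |J| ≤ R - E₀ := le_of_mul_le_mul_right h2 hL0
      have h4 : -(Real.sin A * |J|) ≤ Real.sin A * J := by
        have h4' := mul_le_mul_of_nonneg_left (neg_abs_le J) hsin0
        linarith
      have h5 : Real.sin A * |J| ≤ A * |J| := mul_le_mul_of_nonneg_right hsinA (abs_nonneg _)
      have h6 : 0 ≤ κ * V * A ^ 2 / 2 := by positivity
      linarith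
  -- assemble
  have hexp : (k' * (1 - A ^ 2 / 12) - κ) * (A ^ 2 * V / 2) =
      (A ^ 2 / 2 - A ^ 4 / 24) * (k' * V) - κ * V * A ^ 2 / 2 := by ring
  rw [hexp]
  linarith

/-- **THE LANDAU-WINDOW REDUCTION OF THE FLUX COST** (`L ≥ 3`, flux `0 ≤ θ ≤ min(s, 2)`, window
`w` with `θ²k'/2 + θπ² + θ² ≤ w(1 - θ/2)`). If every unit vector `ψ` of the nonempty sector
`(N, S^z = 0)` of the UNTWISTED tube in the energy window `Re⟨ψ,H₀ψ⟩ - E(0) ≤ wM/L` (i) has kinetic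
form `K(ψ) ≥ k' LM` (KINETIC FLOOR) and (ii) satisfies `min(J(ψ)²/(2κLM), s|J(ψ)|/L) ≤ Re⟨ψ,H₀ψ⟩ - E(0)`
(LANDAU CRITERION), then `E(θ) ≥ E(0) + (k'(1 - (θ/L)²/12) - κ) θ²M/(2L)`; states above the window
need no hypothesis (reverse Bloch bound, `|K| ≤ 2LM`). Falsifier (1) of idea card `landau-window-yrast`
(crux stmt-16312): the reduction is VALID. [cite: Watanabe2019, §2.2.3 and §4.1] -/
theorem tubeEnergy_zero_add_le_of_landauWindow (hL : 3 ≤ L) (U : ℝ) (N : ℕ)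
    (κ s k' w θ : ℝ) (hκ : 0 < κ) (hθ0 : 0 ≤ θ) (hθs : θ ≤ s) (hθ2 : θ ≤ 2) (hk' : 0 ≤ k')
    (hw : θ ^ 2 * k' / 2 + θ * Real.pi ^ 2 + θ ^ 2 ≤ w * (1 - θ / 2))
    (hne : ∃ ψ ∈ szSector (Λ := Λ) N 0, star ψ ⬝ᵥ ψ = (1 : ℂ))
    (hKF : ∀ ψ ∈ szSector (Λ := Λ) N 0, star ψ ⬝ᵥ ψ = (1 : ℂ) →
      (expect (tubeH0 L M Λ e U) ψ).re - tubeEnergy L M Λ e U 0 N ≤ w * M / L →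
        k' * ((L : ℝ) * M) ≤ (∑ a : ZMod L, ∑ b : ZMod M, ∑ σ : Fin 2,
          (expect (creation (orb (e.symm (a, b)) σ) * annihilation (orb (e.symm (a - 1, b)) σ) +
            creation (orb (e.symm (a - 1, b)) σ) * annihilation (orb (e.symm (a, b)) σ)) ψ).re))
    (hLC : ∀ ψ ∈ szSector (Λ := Λ) N 0, star ψ ⬝ᵥ ψ = (1 : ℂ) →
      (expect (tubeH0 L M Λ e U) ψ).re - tubeEnergy L M Λ e U 0 N ≤ w * M / L →
        min ((∑ a : ZMod L, ∑ b : ZMod M, ∑ σ : Fin 2,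
          (expect (creation (orb (e.symm (a, b)) σ) * annihilation (orb (e.symm (a - 1, b)) σ) -
            creation (orb (e.symm (a - 1, b)) σ) * annihilation (orb (e.symm (a, b)) σ)) ψ).im) ^ 2 / (2 * κ * ((L : ℝ) * M))) (s * |(∑ a : ZMod L, ∑ b : ZMod M, ∑ σ : Fin 2,
          (expect (creation (orb (e.symm (a, b)) σ) * annihilation (orb (e.symm (a - 1, b)) σ) -
            creation (orb (e.symm (a - 1, b)) σ) * annihilation (orb (e.symm (a, b)) σ)) ψ).im)| / L) ≤
          (expect (tubeH0 L M Λ e U) ψ).re - tubeEnergy L M Λ e U 0 N) :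
    tubeEnergy L M Λ e U 0 N + (k' * (1 - (θ / L) ^ 2 / 12) - κ) * (θ ^ 2 * M / (2 * L)) ≤
      tubeEnergy L M Λ e U θ N := by
  have hL0 : (0 : ℝ) < L := by exact_mod_cast Nat.pos_of_ne_zero (NeZero.ne L)
  have hM0 : (0 : ℝ) < M := by exact_mod_cast Nat.pos_of_ne_zero (NeZero.ne M)
  have hL3 : (3 : ℝ) ≤ L := by exact_mod_cast hL
  refine le_tubeEnergy_of_forall_landau_ge L M Λ e hL U θ N hne fun ψ hψ h1 => ?_
  by_cases hwin : (expect (tubeH0 L M Λ e U) ψ).re - tubeEnergy L M Λ e U 0 N ≤ w * M / L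
  · exact landauForm_ge_of_windowState L M Λ e hL U N κ s k' θ hκ hθ0 hθs hθ2 hk'
      (hKF ψ hψ h1 hwin) (hLC ψ hψ h1 hwin)
  · -- above the window: reverse Bloch
    push Not at hwin
    set K := (∑ a : ZMod L, ∑ b : ZMod M, ∑ σ : Fin 2,
          (expect (creation (orb (e.symm (a, b)) σ) * annihilation (orb (e.symm (a - 1, b)) σ) +
            creation (orb (e.symm (a - 1, b)) σ) * annihilation (orb (e.symm (a, b)) σ)) ψ).re)
    set J := (∑ a : ZMod L, ∑ b : ZMod M, ∑ σ : Fin 2,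
          (expect (creation (orb (e.symm (a, b)) σ) * annihilation (orb (e.symm (a - 1, b)) σ) -
            creation (orb (e.symm (a - 1, b)) σ) * annihilation (orb (e.symm (a, b)) σ)) ψ).im)
    set R := (expect (tubeH0 L M Λ e U) ψ).re
    set E₀ := tubeEnergy L M Λ e U 0 N
    set V : ℝ := (L : ℝ) * M with hV
    set A : ℝ := θ / L with hA
    set m : ℝ := (M : ℝ) / L with hm
    have hm0 : 0 < m := by positivity
    have hA0 : 0 ≤ A := by positivity
    have hAL : A * L = θ := by rw [hA]; field_simp
    have hmain : θ ^ 2 * (M : ℝ) / (2 * L) = θ ^ 2 * m / 2 := by rw [hm]; field_simp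
    have hA2V : A ^ 2 * V = θ ^ 2 * m := by rw [hA, hV, hm]; field_simp
    have hwm : w * (M : ℝ) / L = w * m := by rw [hm]; ring
    have hPm : 2 * Real.pi ^ 2 * (M : ℝ) / L = 2 * Real.pi ^ 2 * m := by rw [hm]; ring
    rw [hwm] at hwin
    rw [hmain]
    have hsinA : Real.sin A ≤ A := Real.sin_le hA0
    have hsin0 : 0 ≤ Real.sin A :=
      Real.sin_nonneg_of_nonneg_of_le_pi hA0 (by
        rw [hA, div_le_iff₀ hL0]; nlinarith [Real.pi_gt_three])
    have hc0 : 0 ≤ 1 - Real.cos A := by linarith [Real.cos_le_one A]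
    have hcosU : 2 * (1 - Real.cos A) ≤ A ^ 2 := by linarith [two_sub_two_mul_cos_le_sq A]
    -- kinetic part: `(1 - cos A) K ≥ -A² V = -θ² m`
    have hKb := abs_longKinetic_le L M Λ e (by omega) h1
    rw [abs_le] at hKb
    have hV0 : 0 ≤ V := by positivity
    have hkin : -(θ ^ 2 * m) ≤ (1 - Real.cos A) * K := by
      rw [← hA2V]
      have p1 : 0 ≤ (1 - Real.cos A) * (K + 2 * V) := mul_nonneg hc0 (by linarith [hKb.1])
      have p2 : 2 * (1 - Real.cos A) * V ≤ A ^ 2 * V := mul_le_mul_of_nonneg_right hcosU hV0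
      linarith
    -- current part: `sin A J ≥ -A|J| ≥ -(θ/2)(R - E₀ + 2π² m)`
    have hJb := abs_longCurrent_le_of_excitation L M Λ e hL U N hψ h1
    rw [hPm] at hJb
    have hcur : -(θ / 2 * ((R - E₀) + 2 * Real.pi ^ 2 * m)) ≤ Real.sin A * J := by
      have h4 : -(Real.sin A * |J|) ≤ Real.sin A * J := by
        have h4' := mul_le_mul_of_nonneg_left (neg_abs_le J) hsin0
        linarith
      have h5 : Real.sin A * |J| ≤ A * |J| := mul_le_mul_of_nonneg_right hsinA (abs_nonneg J)
      have h6 : A * |J| ≤ A * ((L : ℝ) / 2 * ((R - E₀) + 2 * Real.pi ^ 2 * m)) :=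
        mul_le_mul_of_nonneg_left hJb hA0
      have h7 : A * ((L : ℝ) / 2 * ((R - E₀) + 2 * Real.pi ^ 2 * m)) =
          θ / 2 * ((R - E₀) + 2 * Real.pi ^ 2 * m) := by
        rw [← hAL]; ring
      linarith
    -- the window gap beats everything
    have hgap : w * m * (1 - θ / 2) ≤ (R - E₀) * (1 - θ / 2) :=
      mul_le_mul_of_nonneg_right (by linarith) (by linarith)
    have hwm' : (θ ^ 2 * k' / 2 + θ * Real.pi ^ 2 + θ ^ 2) * m ≤ w * (1 - θ / 2) * m :=
      mul_le_mul_of_nonneg_right hw hm0.le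
    have hk2 : (k' * (1 - A ^ 2 / 12) - κ) * (θ ^ 2 * m / 2) ≤ θ ^ 2 * k' / 2 * m := by
      have h9 : 0 ≤ θ ^ 2 * m * κ := by positivity
      have h10 : 0 ≤ θ ^ 2 * m * (k' * A ^ 2) := by positivity
      linarith
    linarith

/-- **LOCALISATION OF THE LANDAU CRITERION TO THE WINDOW** (`L ≥ 3`, `w > 0`): if the
Landau criterion `min(J(ψ)²/(2κLM), s|J(ψ)|/L) ≤ Re⟨ψ,H₀ψ⟩ - E(0)` holds for the unit vectors of the
sector `(N, 0)` in the window `Re⟨ψ,H₀ψ⟩ - E(0) ≤ wM/L`, then it holds for EVERY unit vector of the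
sector with `s` replaced by `min(s, 2w/(w + 2π²))`: above the window the reverse Bloch bound gives
`(2/L)|J| ≤ sin(π/L)|J| ≤ (1 + 2π²/w)(Re⟨ψ,H₀ψ⟩ - E(0))`, i.e. the linear branch for free. (For
`w ≥ 22` the new slope still exceeds `π/3`, so the global criterion of the registered
`stiffnessOfLandauCriterion` follows from its window version.) [cite: Watanabe2019, §2.2.3 and §4.1] -/
theorem landauCriterion_of_window (hL : 3 ≤ L) (U : ℝ) (N : ℕ) (κ s w : ℝ) (hw : 0 < w)
    (hLC : ∀ ψ ∈ szSector (Λ := Λ) N 0, star ψ ⬝ᵥ ψ = (1 : ℂ) →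
      (expect (tubeH0 L M Λ e U) ψ).re - tubeEnergy L M Λ e U 0 N ≤ w * M / L →
        min ((∑ a : ZMod L, ∑ b : ZMod M, ∑ σ : Fin 2,
          (expect (creation (orb (e.symm (a, b)) σ) * annihilation (orb (e.symm (a - 1, b)) σ) -
            creation (orb (e.symm (a - 1, b)) σ) * annihilation (orb (e.symm (a, b)) σ)) ψ).im) ^ 2 / (2 * κ * ((L : ℝ) * M))) (s * |(∑ a : ZMod L, ∑ b : ZMod M, ∑ σ : Fin 2,
          (expect (creation (orb (e.symm (a, b)) σ) * annihilation (orb (e.symm (a - 1, b)) σ) -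
            creation (orb (e.symm (a - 1, b)) σ) * annihilation (orb (e.symm (a, b)) σ)) ψ).im)| / L) ≤
          (expect (tubeH0 L M Λ e U) ψ).re - tubeEnergy L M Λ e U 0 N)
    {ψ : Fock (Orb Λ)} (hψ : ψ ∈ szSector N 0) (h1 : star ψ ⬝ᵥ ψ = 1) :
    min ((∑ a : ZMod L, ∑ b : ZMod M, ∑ σ : Fin 2,
          (expect (creation (orb (e.symm (a, b)) σ) * annihilation (orb (e.symm (a - 1, b)) σ) -
            creation (orb (e.symm (a - 1, b)) σ) * annihilation (orb (e.symm (a, b)) σ)) ψ).im) ^ 2 / (2 * κ * ((L : ℝ) * M))) (min s (2 * w / (w + 2 * Real.pi ^ 2)) * |(∑ a : ZMod L, ∑ b : ZMod M, ∑ σ : Fin 2,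
          (expect (creation (orb (e.symm (a, b)) σ) * annihilation (orb (e.symm (a - 1, b)) σ) -
            creation (orb (e.symm (a - 1, b)) σ) * annihilation (orb (e.symm (a, b)) σ)) ψ).im)| / L) ≤
      (expect (tubeH0 L M Λ e U) ψ).re - tubeEnergy L M Λ e U 0 N := by
  have hL0 : (0 : ℝ) < L := by exact_mod_cast Nat.pos_of_ne_zero (NeZero.ne L)
  have hM0 : (0 : ℝ) < M := by exact_mod_cast Nat.pos_of_ne_zero (NeZero.ne M)
  set J := (∑ a : ZMod L, ∑ b : ZMod M, ∑ σ : Fin 2,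
          (expect (creation (orb (e.symm (a, b)) σ) * annihilation (orb (e.symm (a - 1, b)) σ) -
            creation (orb (e.symm (a - 1, b)) σ) * annihilation (orb (e.symm (a, b)) σ)) ψ).im)
  set D := (expect (tubeH0 L M Λ e U) ψ).re - tubeEnergy L M Λ e U 0 N
  have hJ0 : 0 ≤ |J| := abs_nonneg _
  by_cases hwin : D ≤ w * M / L
  · refine le_trans (min_le_min le_rfl ?_) (hLC ψ hψ h1 hwin)
    exact div_le_div_of_nonneg_right (mul_le_mul_of_nonneg_right (min_le_left _ _) hJ0) hL0.le
  · push Not at hwin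
    refine (min_le_right _ _).trans ?_
    -- reverse Bloch above the window
    have hB := abs_longCurrent_le_of_excitation L M Λ e hL U N hψ h1
    set m : ℝ := (M : ℝ) / L with hm
    have hwm : w * (M : ℝ) / L = w * m := by rw [hm]; ring
    have hPm : 2 * Real.pi ^ 2 * (M : ℝ) / L = 2 * Real.pi ^ 2 * m := by rw [hm]; ring
    rw [hwm] at hwin
    rw [hPm] at hB
    have hm0 : 0 < m := by positivity
    have hD0 : 0 < D := lt_of_le_of_lt (by positivity) hwin
    -- `2π² m < (2π²/w) D`
    have h2 : 2 * Real.pi ^ 2 * m * w ≤ 2 * Real.pi ^ 2 * D := by nlinarith [Real.pi_pos]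
    -- `|J| ≤ (L/2) D (w + 2π²)/w`
    have h3 : |J| * (2 * w) ≤ L * D * (w + 2 * Real.pi ^ 2) := by nlinarith
    have hslope : 2 * w / (w + 2 * Real.pi ^ 2) * |J| / L ≤ D := by
      rw [div_mul_eq_mul_div, div_div, div_le_iff₀ (by positivity)]
      nlinarith
    refine le_trans ?_ hslope
    exact div_le_div_of_nonneg_right (mul_le_mul_of_nonneg_right (min_le_right _ _) hJ0) hL0.le

end LandauWindow

section StiffnessFloor

variable (L M : ℕ) [NeZero L] [NeZero M] (Λ : Type) [LinearOrder Λ] [Fintype Λ]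
  (e : Λ ≃ ZMod L × ZMod M)

omit [NeZero L] [NeZero M] [LinearOrder Λ] [Fintype Λ] in
/-- The numerical window condition at the crux flux `θ₀ = π/3`: for `k' ≤ 2` and `w ≥ 27`,
`θ₀²k'/2 + θ₀π² + θ₀² ≤ w(1 - θ₀/2)` (`π < 3.15`). [folklore] -/
theorem landauWindow_condition_pi_div_three {k' w : ℝ} (hk'2 : k' ≤ 2) (hw : 27 ≤ w) :
    (Real.pi / 3) ^ 2 * k' / 2 + Real.pi / 3 * Real.pi ^ 2 + (Real.pi / 3) ^ 2 ≤ w * (1 - Real.pi / 3 / 2) := by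
  have hπ := Real.pi_lt_d2
  have hπ0 := Real.pi_gt_three
  have hπ2 : Real.pi ^ 2 < 3.15 ^ 2 := by nlinarith
  have hπ3 : Real.pi ^ 3 < 3.15 ^ 3 := by nlinarith
  have h1 : (Real.pi / 3) ^ 2 * k' / 2 ≤ (Real.pi / 3) ^ 2 * 2 / 2 := by
    have : 0 ≤ (Real.pi / 3) ^ 2 := by positivity
    nlinarith
  have h2 : 27 * (1 - Real.pi / 3 / 2) ≤ w * (1 - Real.pi / 3 / 2) :=
    mul_le_mul_of_nonneg_right hw (by linarith)
  nlinarith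

/-- **THE LANDAU-WINDOW REDUCTION OF THE STIFFNESS FLOOR** (conjunct (i) of the tube cruxes
16311/16312/18509/18510; `L ≥ 3`, `δ ≥ -1`, `κ > 0`, `s ≥ π/3`, `0 ≤ k' ≤ 2`, ONE window `w ≥ 27`):
KINETIC FLOOR `K(ψ) ≥ k' LM` and LANDAU CRITERION `min(J(ψ)²/(2κLM), s|J(ψ)|/L) ≤ Re⟨ψ,H₀ψ⟩ - E(0)`
for the unit vectors of the sector `(N_{L,M}(δ), 0)` of the untwisted tube in the window
`Re⟨ψ,H₀ψ⟩ - E(0) ≤ wM/L` give `ρ̃_{L,M}(U, δ) ≥ k'(1 - (π/3L)²/12) - κ` (vs. the registered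
`stiffnessOfLandauCriterion`: criterion on window states only). Neither hypothesis is claimed here
(they carry the physics: idea card `landau-window-yrast`, crux stmt-16312). [cite: ScalapinoWhiteZhang1993, §II] -/
theorem tubeStiffness_ge_of_landauWindow (hL : 3 ≤ L) (U δ : ℝ) (hδ : -1 ≤ δ)
    (κ s k' w : ℝ) (hκ : 0 < κ) (hs : Real.pi / 3 ≤ s) (hk' : 0 ≤ k') (hk'2 : k' ≤ 2) (hw : 27 ≤ w)
    (hKF : ∀ ψ ∈ szSector (Λ := Λ) (tubeFilling L M δ) 0, star ψ ⬝ᵥ ψ = (1 : ℂ) →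
      (expect (tubeH0 L M Λ e U) ψ).re - tubeEnergy L M Λ e U 0 (tubeFilling L M δ) ≤ w * M / L →
        k' * ((L : ℝ) * M) ≤ (∑ a : ZMod L, ∑ b : ZMod M, ∑ σ : Fin 2,
          (expect (creation (orb (e.symm (a, b)) σ) * annihilation (orb (e.symm (a - 1, b)) σ) +
            creation (orb (e.symm (a - 1, b)) σ) * annihilation (orb (e.symm (a, b)) σ)) ψ).re))
    (hLC : ∀ ψ ∈ szSector (Λ := Λ) (tubeFilling L M δ) 0, star ψ ⬝ᵥ ψ = (1 : ℂ) →
      (expect (tubeH0 L M Λ e U) ψ).re - tubeEnergy L M Λ e U 0 (tubeFilling L M δ) ≤ w * M / L →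
        min ((∑ a : ZMod L, ∑ b : ZMod M, ∑ σ : Fin 2,
          (expect (creation (orb (e.symm (a, b)) σ) * annihilation (orb (e.symm (a - 1, b)) σ) -
            creation (orb (e.symm (a - 1, b)) σ) * annihilation (orb (e.symm (a, b)) σ)) ψ).im) ^ 2 / (2 * κ * ((L : ℝ) * M))) (s * |(∑ a : ZMod L, ∑ b : ZMod M, ∑ σ : Fin 2,
          (expect (creation (orb (e.symm (a, b)) σ) * annihilation (orb (e.symm (a - 1, b)) σ) -
            creation (orb (e.symm (a - 1, b)) σ) * annihilation (orb (e.symm (a, b)) σ)) ψ).im)| / L) ≤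
          (expect (tubeH0 L M Λ e U) ψ).re - tubeEnergy L M Λ e U 0 (tubeFilling L M δ)) :
    k' * (1 - (Real.pi / 3 / L) ^ 2 / 12) - κ ≤ tubeStiffness L M Λ e U δ := by
  have hL0 : (0 : ℝ) < L := by exact_mod_cast Nat.pos_of_ne_zero (NeZero.ne L)
  have hM0 : (0 : ℝ) < M := by exact_mod_cast Nat.pos_of_ne_zero (NeZero.ne M)
  have hπ0 := Real.pi_gt_three
  have hπ := Real.pi_lt_d2
  have hne : ∃ ψ ∈ szSector (Λ := Λ) (tubeFilling L M δ) 0, star ψ ⬝ᵥ ψ = (1 : ℂ) := by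
    obtain ⟨ψ, h1, hgs⟩ := exists_unit_isGroundStateInSector_tubeH0_tubeFilling L M Λ e U hδ
    exact ⟨ψ, hgs.1, h1⟩
  have h := tubeEnergy_zero_add_le_of_landauWindow L M Λ e hL U (tubeFilling L M δ) κ s k' w
    (Real.pi / 3) hκ (by positivity) hs (by linarith) hk' (landauWindow_condition_pi_div_three hk'2 hw)
    hne hKF hLC
  rw [tubeStiffness_eq, le_div_iff₀ (by positivity)]
  have key : (k' * (1 - (Real.pi / 3 / L) ^ 2 / 12) - κ) * ((Real.pi / 3) ^ 2 * M) =
      2 * L * ((k' * (1 - (Real.pi / 3 / L) ^ 2 / 12) - κ) * ((Real.pi / 3) ^ 2 * M / (2 * L))) := by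
    field_simp
  rw [key]
  nlinarith [mul_le_mul_of_nonneg_left h (by positivity : (0 : ℝ) ≤ 2 * L)]

end StiffnessFloor
end Summit.HubbardSuperconductivity.HubbardSuperconductivity.Theorems.WidthHaldane

end
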